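import Literature.Computability.Cryptography.KitaevPhaseEstimationSums
import HarnessLib

/-!
# Period finding by eigenvalue estimation of shifts, V: product laws and the two-hit rule

Family `PQC` / quantum-advantage barrier `PPolyOracles`; fifth file towards the discharge of
`Literature.Barriers.QuantumAdvantage.aaronsonChen2017_lem75_quantum` (Aaronson–Chen 2017,
Lemma 7.5 (2)–(3), App. 13). The read-out law of the shift experiment
(`PeriodFindingLaw.sandwich_law`) is a PRODUCT over the units (candidate block length × trial)
of per-unit laws (`∑_c ∏_u w_u(c_u) ∏_u P_{c_u}(γ_u) = ∏_u ∑_{c} w_u(c) P_c(γ_u)`). This file is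
the elementary probability of finite product laws that the distinguisher's decision rule needs,
kept abstract (units `U`, per-unit outcome types `X u`, per-unit weights `μ u`):

* `pw`, `prob`, `IsProbVec`; `prob_mono`, `prob_union_le`, `prob_biUnion_le`, `prob_univ`,
  `prob_compl`, `prob_piFinset` (product events), the one- and two-coordinate marginals
  `sum_pw_mul_apply`, `prob_filter_apply`, `sum_pw_mul_apply₂`;
* **the two-hit rule** of the distinguisher ("the period is found at a length iff two distinct
  trials at that length return the same candidate `≥ 2`"; the printed distinguisher of App. 13
  confirms one candidate by re-querying `f`, which the tree's classical wrapper cannot do after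
  the measurement — agreement of independent trials replaces the confirmation):
  `prob_exists_mem_ge` (detection: if every unit of `S` succeeds with probability `≥ p` then some
  unit succeeds with probability `≥ 1 − (1−p)^{|S|}`), `prob_twoHalves_ge`, and
  `prob_collision_le` (false collisions: if every candidate value `≥ 2` has per-unit probability
  `≤ ε`, two distinct units of `S` agree on a value `≥ 2` with probability `≤ |S|² ε`).

## References

* S. Aaronson, L. Chen, CCC 2017 (arXiv:1612.05903), Lemma 7.5 (2)–(3), App. 13 [AaronsonChen2017].
* A. Yu. Kitaev, arXiv:quant-ph/9511026 (1995), §3 Lemma 8 (independent tests) [Kitaev1995].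
-/

noncomputable section

namespace Literature.Computability.Cryptography

namespace PeriodFinding

open Finset

section ProductLaw

variable {U : Type*} [Fintype U] {X : U → Type*} [∀ u, Fintype (X u)]

/-- The product weight of an outcome vector. [folklore] -/
def pw (μ : (u : U) → X u → ℝ) (γ : (u : U) → X u) : ℝ := ∏ u, μ u (γ u)

/-- The probability of an event under the product law. [folklore] -/
def prob (μ : (u : U) → X u → ℝ) (E : Finset ((u : U) → X u)) : ℝ := ∑ γ ∈ E, pw μ γ

/-- Per-unit weights forming probability vectors. [folklore] -/
structure IsProbVec (μ : (u : U) → X u → ℝ) : Prop where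
  /-- weights are nonnegative -/
  nonneg : ∀ u x, 0 ≤ μ u x
  /-- and sum to one -/
  total : ∀ u, ∑ x, μ u x = 1

variable {μ : (u : U) → X u → ℝ}

/-- Product weights are nonnegative. [folklore] -/
theorem pw_nonneg (hμ : IsProbVec μ) (γ : (u : U) → X u) : 0 ≤ pw μ γ :=
  prod_nonneg fun u _ => hμ.nonneg u _

/-- Probabilities are nonnegative. [folklore] -/
theorem prob_nonneg (hμ : IsProbVec μ) (E : Finset ((u : U) → X u)) : 0 ≤ prob μ E :=
  sum_nonneg fun γ _ => pw_nonneg hμ γ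

/-- Monotonicity. [folklore] -/
theorem prob_mono (hμ : IsProbVec μ) {E F : Finset ((u : U) → X u)} (h : E ⊆ F) :
    prob μ E ≤ prob μ F :=
  sum_le_sum_of_subset_of_nonneg h fun γ _ _ => pw_nonneg hμ γ

/-- Union bound for two events. [folklore] -/
theorem prob_union_le [∀ u, DecidableEq (X u)] (hμ : IsProbVec μ) (E F : Finset ((u : U) → X u)) :
    prob μ (E ∪ F) ≤ prob μ E + prob μ F := by
  unfold prob
  rw [← sum_union_inter]
  have := sum_nonneg (s := E ∩ F) fun γ _ => pw_nonneg hμ γ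
  linarith

/-- Union bound for a finite family of events. [folklore] -/
theorem prob_biUnion_le [∀ u, DecidableEq (X u)] {ι : Type*} [DecidableEq ι] (hμ : IsProbVec μ) (I : Finset ι)
    (E : ι → Finset ((u : U) → X u)) : prob μ (I.biUnion E) ≤ ∑ i ∈ I, prob μ (E i) := by
  induction I using Finset.induction_on with
  | empty => simp [prob]
  | @insert i I hi ih =>
    rw [biUnion_insert, sum_insert hi]
    exact (prob_union_le hμ _ _).trans (by linarith)

omit [∀ u, Fintype (X u)] in
/-- **Product events have product probability**: `P(∀ u, γ_u ∈ t_u) = ∏_u μ_u(t_u)`. [folklore] -/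
theorem prob_piFinset [DecidableEq U] (t : (u : U) → Finset (X u)) :
    prob μ (Fintype.piFinset t) = ∏ u, ∑ x ∈ t u, μ u x :=
  (prod_univ_sum t μ).symm

/-- Total probability one. [folklore] -/
theorem prob_univ [DecidableEq U] (hμ : IsProbVec μ) : prob μ univ = 1 := by
  rw [← Fintype.piFinset_univ, prob_piFinset]
  exact prod_eq_one fun u _ => hμ.total u

/-- Probabilities are at most one. [folklore] -/
theorem prob_le_one [DecidableEq U] (hμ : IsProbVec μ) (E : Finset ((u : U) → X u)) : prob μ E ≤ 1 :=
  (prob_mono hμ (subset_univ E)).trans (prob_univ hμ).le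

/-- Complements. [folklore] -/
theorem prob_compl [DecidableEq U] [∀ u, DecidableEq (X u)] (hμ : IsProbVec μ) (E : Finset ((u : U) → X u)) :
    prob μ Eᶜ = 1 - prob μ E := by
  have h := sum_add_sum_compl E (pw μ)
  have hu := prob_univ hμ
  unfold prob at hu ⊢
  linarith

/-- The general form of `P(A ∩ B) ≥ 1 − P(Aᶜ) − P(Bᶜ)`. [folklore] -/
theorem prob_inter_ge [DecidableEq U] [∀ u, DecidableEq (X u)] (hμ : IsProbVec μ) (E F : Finset ((u : U) → X u)) :
    1 - prob μ Eᶜ - prob μ Fᶜ ≤ prob μ (E ∩ F) := by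
  have h1 : prob μ (E ∩ F)ᶜ ≤ prob μ Eᶜ + prob μ Fᶜ := by
    rw [compl_inter]
    exact prob_union_le hμ _ _
  rw [prob_compl hμ] at h1
  linarith

/-! ### Marginals of one and two coordinates -/

/-- Absorbing a function of coordinate `u` into the weights: the modified weight vector. [folklore] -/
def absorb [DecidableEq U] (ν : (u : U) → X u → ℝ) (u : U) (g : X u → ℝ) : (u : U) → X u → ℝ :=
  Function.update ν u fun x => ν u x * g x

omit [∀ u, Fintype (X u)] in
/-- The product weight with a function of coordinate `u` absorbed. [folklore] -/
theorem prod_absorb [DecidableEq U] (ν : (u : U) → X u → ℝ) (u : U) (g : X u → ℝ) (γ : (u : U) → X u) :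
    ∏ u', absorb ν u g u' (γ u') = (∏ u', ν u' (γ u')) * g (γ u) := by
  have hf : (fun u' => absorb ν u g u' (γ u')) =
      Function.update (fun u' => ν u' (γ u')) u (ν u (γ u) * g (γ u)) := by
    funext u'
    by_cases h : u' = u
    · subst h
      simp [absorb]
    · simp [absorb, Function.update_of_ne h]
  rw [hf, prod_update_of_mem (mem_univ u), sdiff_singleton_eq_erase,
    ← mul_prod_erase univ (fun u' => ν u' (γ u')) (mem_univ u)]
  ring

/-- **One-coordinate marginal** (general weights): the expectation of a function of coordinate
`u` under the product weight. [folklore] -/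
theorem sum_pw_mul_apply [DecidableEq U] (ν : (u : U) → X u → ℝ) (u : U) (g : X u → ℝ) :
    ∑ γ : (u : U) → X u, (∏ u', ν u' (γ u')) * g (γ u) =
      (∑ x, ν u x * g x) * ∏ u' ∈ univ.erase u, ∑ x, ν u' x := by
  rw [← sum_congr rfl fun γ _ => prod_absorb ν u g γ, ← Fintype.prod_sum,
    ← mul_prod_erase univ _ (mem_univ u)]
  congr 1
  · simp [absorb]
  · refine prod_congr rfl fun u' hu' => ?_
    rw [mem_erase] at hu'
    simp [absorb, Function.update_of_ne hu'.1]

/-- One-coordinate marginal under a probability vector: `E[g(γ_u)] = ∑_x μ_u(x) g(x)`. [folklore] -/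
theorem sum_pw_mul_apply_eq [DecidableEq U] (hμ : IsProbVec μ) (u : U) (g : X u → ℝ) :
    ∑ γ : (u : U) → X u, pw μ γ * g (γ u) = ∑ x, μ u x * g x := by
  unfold pw
  rw [sum_pw_mul_apply, prod_eq_one fun u' _ => hμ.total u', mul_one]

/-- The probability that coordinate `u` lies in `D`. [folklore] -/
theorem prob_filter_apply [DecidableEq U] [∀ u, DecidableEq (X u)] (hμ : IsProbVec μ) (u : U) (D : Finset (X u)) :
    prob μ (univ.filter fun γ => γ u ∈ D) = ∑ x ∈ D, μ u x := by
  unfold prob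
  rw [sum_filter, ← sum_congr rfl fun γ _ => show pw μ γ * (if γ u ∈ D then 1 else 0) =
      if γ u ∈ D then pw μ γ else 0 by split_ifs <;> simp,
    sum_pw_mul_apply_eq hμ u fun x => if x ∈ D then 1 else 0]
  simp only [mul_ite, mul_one, mul_zero]
  rw [← sum_filter, filter_mem_eq_inter, univ_inter]

/-- **Two-coordinate marginal**: for distinct units `u ≠ u'` the expectation of a function of
`(γ_u, γ_{u'})` factorises over the two marginals (independence of distinct units).
[cite: Kitaev1995, §3 Lemma 8] -/
theorem sum_pw_mul_apply₂ [DecidableEq U] [∀ u, DecidableEq (X u)] (hμ : IsProbVec μ) {u u' : U} (huu : u ≠ u') (F : X u → X u' → ℝ) :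
    ∑ γ : (u : U) → X u, pw μ γ * F (γ u) (γ u') = ∑ x, ∑ x', μ u x * μ u' x' * F x x' := by
  classical
  -- expand `F (γ u) (γ u') = ∑_x [γ u = x] F x (γ u')`
  have hexp : ∀ γ : (u : U) → X u, pw μ γ * F (γ u) (γ u') =
      ∑ x, (∏ u'', absorb μ u (fun y => if y = x then 1 else 0) u'' (γ u'')) * F x (γ u') := by
    intro γ
    simp_rw [prod_absorb]
    rw [← pw]
    simp
  rw [sum_congr rfl fun γ _ => hexp γ, sum_comm]
  refine sum_congr rfl fun x _ => ?_
  rw [sum_pw_mul_apply (absorb μ u fun y => if y = x then 1 else 0) u' (F x)]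
  -- the marginal factors: at `u'` the weights are unchanged, at `u` the total is `μ u x`
  have hu' : ∀ y, absorb μ u (fun y => if y = x then 1 else 0) u' y = μ u' y := fun y => by
    simp [absorb, Function.update_of_ne (Ne.symm huu)]
  simp_rw [hu']
  rw [← mul_prod_erase (univ.erase u') _ (mem_erase.2 ⟨huu, mem_univ u⟩)]
  have h1 : (∑ y, absorb μ u (fun y => if y = x then (1 : ℝ) else 0) u y) = μ u x := by
    simp [absorb, Finset.sum_ite_eq']
  have h2 : ∏ u'' ∈ (univ.erase u').erase u,
      (∑ y, absorb μ u (fun y => if y = x then (1 : ℝ) else 0) u'' y) = 1 := by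
    refine prod_eq_one fun u'' hu'' => ?_
    have hne : u'' ≠ u := (mem_erase.1 hu'').1
    simp [absorb, Function.update_of_ne hne, hμ.total u'']
  rw [h1, h2, mul_one, mul_comm, mul_sum]
  refine sum_congr rfl fun x' _ => ?_
  ring

/-! ### The two-hit rule: detection -/

/-- **Detection**: if every unit of `S` shows the outcome set `D_u` with probability at least
`p`, then some unit of `S` shows it with probability at least `1 − (1 − p)^{|S|}`
(the complement is a product event). [folklore] -/
theorem prob_exists_mem_ge [DecidableEq U] [∀ u, DecidableEq (X u)] (hμ : IsProbVec μ) (S : Finset U) (D : (u : U) → Finset (X u))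
    {p : ℝ} (hp : ∀ u ∈ S, p ≤ ∑ x ∈ D u, μ u x) :
    1 - (1 - p) ^ S.card ≤ prob μ (univ.filter fun γ => ∃ u ∈ S, γ u ∈ D u) := by
  classical
  -- the complement is the product event `∀ u ∈ S, γ u ∉ D u`
  set t : (u : U) → Finset (X u) := fun u => if u ∈ S then (D u)ᶜ else univ with ht
  have hcompl : (univ.filter fun γ : (u : U) → X u => ∃ u ∈ S, γ u ∈ D u)ᶜ = Fintype.piFinset t := by
    ext γ
    simp only [mem_compl, mem_filter, mem_univ, true_and, not_exists, not_and,
      Fintype.mem_piFinset, ht]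
    constructor
    · intro h u
      split_ifs with hu
      · exact mem_compl.2 (h u hu)
      · exact mem_univ _
    · intro h u hu
      have := h u
      rw [if_pos hu] at this
      exact mem_compl.1 this
  have hprod : prob μ (Fintype.piFinset t) ≤ (1 - p) ^ S.card := by
    rw [prob_piFinset]
    have hfac : ∀ u, ∑ x ∈ t u, μ u x = if u ∈ S then 1 - ∑ x ∈ D u, μ u x else 1 := by
      intro u
      simp only [ht]
      split_ifs with hu
      · have := sum_add_sum_compl (D u) (μ u)
        rw [hμ.total u] at this
        linarith
      · exact hμ.total u
    simp_rw [hfac]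
    rw [prod_ite, prod_const_one, mul_one, filter_mem_eq_inter, univ_inter]
    calc ∏ u ∈ S, (1 - ∑ x ∈ D u, μ u x) ≤ ∏ _u ∈ S, (1 - p) := by
          refine prod_le_prod (fun u hu => ?_) (fun u hu => by linarith [hp u hu])
          have := sum_le_sum_of_subset_of_nonneg (subset_univ (D u)) fun x _ _ => hμ.nonneg u x
          rw [hμ.total u] at this
          linarith
      _ = (1 - p) ^ S.card := prod_const _
  have hc := prob_compl hμ (univ.filter fun γ : (u : U) → X u => ∃ u ∈ S, γ u ∈ D u)
  rw [hcompl] at hc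
  linarith

/-- **Detection by two halves**: if every unit of `S₁` and of `S₂` shows `D_u` with probability
`≥ p`, then with probability `≥ 1 − (1−p)^{|S₁|} − (1−p)^{|S₂|}` some unit of `S₁` AND some unit
of `S₂` show it. [folklore] -/
theorem prob_twoHalves_ge [DecidableEq U] [∀ u, DecidableEq (X u)] (hμ : IsProbVec μ) (S₁ S₂ : Finset U) (D : (u : U) → Finset (X u))
    {p : ℝ} (hp₁ : ∀ u ∈ S₁, p ≤ ∑ x ∈ D u, μ u x) (hp₂ : ∀ u ∈ S₂, p ≤ ∑ x ∈ D u, μ u x) :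
    1 - (1 - p) ^ S₁.card - (1 - p) ^ S₂.card ≤
      prob μ ((univ.filter fun γ => ∃ u ∈ S₁, γ u ∈ D u) ∩
        (univ.filter fun γ => ∃ u ∈ S₂, γ u ∈ D u)) := by
  have h1 := prob_exists_mem_ge hμ S₁ D hp₁
  have h2 := prob_exists_mem_ge hμ S₂ D hp₂
  have h3 := prob_inter_ge hμ (univ.filter fun γ => ∃ u ∈ S₁, γ u ∈ D u)
    (univ.filter fun γ => ∃ u ∈ S₂, γ u ∈ D u)
  rw [prob_compl hμ, prob_compl hμ] at h3
  linarith

/-! ### The two-hit rule: false collisions -/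

/-- **A collision of two given distinct units is rare**: if at unit `u'` every value `≥ 2` of
`V` has probability `≤ ε`, then `V_u(γ_u) = V_{u'}(γ_{u'}) ≥ 2` has probability `≤ ε`. [folklore] -/
theorem prob_pairCollision_le [DecidableEq U] [∀ u, DecidableEq (X u)] (hμ : IsProbVec μ) (V : (u : U) → X u → ℕ) {u u' : U} (huu : u ≠ u')
    {ε : ℝ} (hε : ∀ v, 2 ≤ v → ∑ x ∈ univ.filter (fun x => V u' x = v), μ u' x ≤ ε) :
    prob μ (univ.filter fun γ => V u (γ u) = V u' (γ u') ∧ 2 ≤ V u (γ u)) ≤ ε := by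
  classical
  unfold prob
  rw [sum_filter, ← sum_congr rfl fun γ _ => show pw μ γ *
      (if V u (γ u) = V u' (γ u') ∧ 2 ≤ V u (γ u) then 1 else 0) =
      if V u (γ u) = V u' (γ u') ∧ 2 ≤ V u (γ u) then pw μ γ else 0 by split_ifs <;> simp,
    sum_pw_mul_apply₂ hμ huu fun x x' => if V u x = V u' x' ∧ 2 ≤ V u x then (1 : ℝ) else 0]
  -- for each `x` with `V x ≥ 2` the inner sum is the probability of the value `V x` at `u'`
  have hinner : ∀ x, ∑ x', μ u x * μ u' x' * (if V u x = V u' x' ∧ 2 ≤ V u x then (1 : ℝ) else 0)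
      ≤ μ u x * ε := by
    intro x
    by_cases hx : 2 ≤ V u x
    · rw [← sum_congr rfl fun x' _ => show μ u x * (if V u' x' = V u x then μ u' x' else 0) =
          μ u x * μ u' x' * (if V u x = V u' x' ∧ 2 ≤ V u x then (1 : ℝ) else 0) by
            by_cases h : V u' x' = V u x
            · rw [if_pos h, if_pos ⟨h.symm, hx⟩, mul_one]
            · rw [if_neg h, if_neg (fun h' => h h'.1.symm), mul_zero, mul_zero],
        ← mul_sum, ← sum_filter]
      exact mul_le_mul_of_nonneg_left (hε _ hx) (hμ.nonneg u x)
    · rw [sum_congr rfl fun x' _ => show μ u x * μ u' x' *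
          (if V u x = V u' x' ∧ 2 ≤ V u x then (1 : ℝ) else 0) = 0 by
            rw [if_neg (fun h => hx h.2), mul_zero], sum_const_zero]
      have h0 : 0 ≤ ε := le_trans (sum_nonneg fun x' _ => hμ.nonneg u' x') (hε 2 le_rfl)
      exact mul_nonneg (hμ.nonneg u x) h0
  calc ∑ x, ∑ x', μ u x * μ u' x' * (if V u x = V u' x' ∧ 2 ≤ V u x then (1 : ℝ) else 0)
      ≤ ∑ x, μ u x * ε := sum_le_sum fun x _ => hinner x
    _ = ε := by rw [← sum_mul, hμ.total u, one_mul]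

/-- **False collisions are rare** (the two-hit rule on permutation tables): if at every unit of
`S` every candidate value `≥ 2` has probability `≤ ε`, then two distinct units of `S` return the
same value `≥ 2` with probability `≤ |S|² ε` (union bound over the ordered pairs).
[cite: AaronsonChen2017, App. 13 (proof of Lemma 7.5 (3))] -/
theorem prob_collision_le [DecidableEq U] [∀ u, DecidableEq (X u)] (hμ : IsProbVec μ) (S : Finset U) (V : (u : U) → X u → ℕ) {ε : ℝ}
    (hε : ∀ u ∈ S, ∀ v, 2 ≤ v → ∑ x ∈ univ.filter (fun x => V u x = v), μ u x ≤ ε) :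
    prob μ (univ.filter fun γ => ∃ u ∈ S, ∃ u' ∈ S, u ≠ u' ∧ V u (γ u) = V u' (γ u') ∧
      2 ≤ V u (γ u)) ≤ (S.card : ℝ) ^ 2 * ε := by
  classical
  have hε0 : ∀ u ∈ S, 0 ≤ ε := fun u hu =>
    le_trans (sum_nonneg fun x _ => hμ.nonneg u x) (hε u hu 2 le_rfl)
  -- the event is the union over the ordered pairs of distinct units of `S`
  have hsub : (univ.filter fun γ : (u : U) → X u => ∃ u ∈ S, ∃ u' ∈ S, u ≠ u' ∧
      V u (γ u) = V u' (γ u') ∧ 2 ≤ V u (γ u)) ⊆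
      S.offDiag.biUnion fun p => univ.filter fun γ => V p.1 (γ p.1) = V p.2 (γ p.2) ∧
        2 ≤ V p.1 (γ p.1) := by
    intro γ hγ
    simp only [mem_filter, mem_univ, true_and] at hγ
    obtain ⟨u, hu, u', hu', hne, hV, h2⟩ := hγ
    exact mem_biUnion.2 ⟨(u, u'), mem_offDiag.2 ⟨hu, hu', hne⟩, mem_filter.2 ⟨mem_univ _, hV, h2⟩⟩
  refine (prob_mono hμ hsub).trans ((prob_biUnion_le hμ _ _).trans ?_)
  rcases S.eq_empty_or_nonempty with rfl | hne
  · simp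
  · obtain ⟨u₀, hu₀⟩ := hne
    calc ∑ p ∈ S.offDiag, prob μ (univ.filter fun γ => V p.1 (γ p.1) = V p.2 (γ p.2) ∧
          2 ≤ V p.1 (γ p.1))
        ≤ ∑ _p ∈ S.offDiag, ε := sum_le_sum fun p hp => by
            obtain ⟨-, hp2, hne⟩ := mem_offDiag.1 hp
            exact prob_pairCollision_le hμ V hne (hε p.2 hp2)
      _ = (S.offDiag.card : ℝ) * ε := by rw [sum_const, nsmul_eq_mul]
      _ ≤ (S.card : ℝ) ^ 2 * ε := by
          refine mul_le_mul_of_nonneg_right ?_ (hε0 u₀ hu₀)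
          rw [offDiag_card]
          have : (S.card * S.card - S.card : ℕ) ≤ S.card ^ 2 := by
            rw [sq]; exact Nat.sub_le _ _
          exact_mod_cast this

end ProductLaw

end PeriodFinding

end Literature.Computability.Cryptography

end
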